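import Literature.NumberTheory.LFunctions.DirichletLTruncationPacked
import HarnessLib

/-!
# Packed truncation certificates — all cells of a leaf (the fixed-point chains)

Generic lemma for the soundness of `LTruncationPacked.certTcells`: along the sorted cell list, `leafCells` feeds every cell
`(i, w)` the four chain values with the enclosures `c0l ≤ 2^P x₀^{-i/E} ≤ c0h`, `2^P x₁^{-i/E} ≤ c1h`, `cml ≤ 2^P x_m^{-i/E}`
(`E = 2^J`; from `stepLo_le` / `le_stepHi` and the root lists of the leaf), so that any per-cell implication
`Inv → Inv'` proved for ONE cell under these enclosures lifts to the aligned state lists.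
[cite: Chua2005RealZeros, §2.2 ALGO 1]
-/

namespace Literature.NumberTheory.LFunctions

namespace LTruncationPacked

open Finset FeketePolyaKernel LTruncationCert Literature.Analysis.Convolution

/-- `fcons` is `cons`. [folklore] -/
private theorem fcons_eq (z : ℤ) (n : ℕ) (rest : List (ℤ × ℕ)) : fcons z n rest = (z, n) :: rest := by
  rcases z with x | x <;> rcases n with _ | y <;> rfl

/-- Exponent bookkeeping along the chain: `iPrev/E + (i − iPrev)·2^0/2^J = i/E` (`E = 2^J`, `iPrev ≤ i`). [folklore] -/
private theorem exp_step {E J iPrev i : ℕ} (hE : E = 2 ^ J) (hle : iPrev ≤ i) :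
    (iPrev : ℝ) / E + ((i - iPrev : ℕ) : ℝ) * (2 : ℝ) ^ (0 : ℕ) / (2 : ℝ) ^ J = (i : ℝ) / E := by
  rw [hE, Nat.cast_sub hle]; push_cast; ring

/-- **All cells of a leaf.** [cite: Chua2005RealZeros, §2.2 ALGO 1] -/
theorem leafCells_spec {b P E J : ℕ} (hE : E = 2 ^ J) (ld : LeafData) {x0 x1 xm : ℕ} (hx0 : 1 ≤ x0) (hx1 : 1 ≤ x1)
    (hxm : 1 ≤ xm) (hr0l : RootsLow P x0 J ld.r0l) (hr0h : RootsUp P x0 J ld.r0h) (hr1h : RootsUp P x1 J ld.r1h)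
    (hrml : RootsLow P xm J ld.rml) (Inv Inv' : (ℕ × ℕ) → (ℤ × ℕ) → Prop)
    (H : ∀ (i w c0l c0h c1h cml : ℕ) (pref : ℤ) (d : ℕ) (pref' : ℤ) (d' : ℕ),
      (c0l : ℝ) ≤ (2 : ℝ) ^ P * (x0 : ℝ) ^ (-((i : ℝ) / E)) →
      (2 : ℝ) ^ P * (x0 : ℝ) ^ (-((i : ℝ) / E)) ≤ c0h →
      (2 : ℝ) ^ P * (x1 : ℝ) ^ (-((i : ℝ) / E)) ≤ c1h →
      (cml : ℝ) ≤ (2 : ℝ) ^ P * (xm : ℝ) ^ (-((i : ℝ) / E)) →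
      Inv (i, w) (pref, d) → leafCell b P E ld i c0l c0h c1h cml pref d = some (pref', d') → Inv' (i, w) (pref', d')) :
    ∀ (cells : List (ℕ × ℕ)) (st : List (ℤ × ℕ)) (iPrev c0l c0h c1h cml : ℕ),
      (c0l : ℝ) ≤ (2 : ℝ) ^ P * (x0 : ℝ) ^ (-((iPrev : ℝ) / E)) →
      (2 : ℝ) ^ P * (x0 : ℝ) ^ (-((iPrev : ℝ) / E)) ≤ c0h →
      (2 : ℝ) ^ P * (x1 : ℝ) ^ (-((iPrev : ℝ) / E)) ≤ c1h →
      (cml : ℝ) ≤ (2 : ℝ) ^ P * (xm : ℝ) ^ (-((iPrev : ℝ) / E)) →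
      List.Forall₂ Inv cells st →
      ∀ st', leafCells b P E ld iPrev c0l c0h c1h cml cells st = some st' → List.Forall₂ Inv' cells st' := by
  intro cells
  induction cells with
  | nil =>
    intro st iPrev c0l c0h c1h cml _ _ _ _ hinv st' h
    cases hinv
    simp only [leafCells, Option.some.injEq] at h
    rw [← h]; exact List.Forall₂.nil
  | cons iw cells ih =>
    intro st iPrev c0l c0h c1h cml hc0l hc0h hc1h hcml hinv st' h
    obtain ⟨i, w⟩ := iw
    cases hinv with
    | cons hhead htail =>
      rename_i pd st₀
      obtain ⟨pref, d⟩ := pd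
      simp only [leafCells] at h
      cases hblt : Nat.blt i iPrev with
      | true => simp [hblt] at h
      | false =>
        simp only [hblt, cond_false] at h
        have hle : iPrev ≤ i := by
          by_contra hlt
          have : Nat.blt i iPrev = true := Nat.blt_eq.mpr (by omega)
          rw [this] at hblt; exact Bool.noConfusion hblt
        have hiPrev0 : (0 : ℝ) ≤ (iPrev : ℝ) / E := by positivity
        -- the four chain enclosures at `i`
        set J1 := ld.r0l.length + 1 with hJ1
        have e1 := exp_step hE hle
        have hc0l' : ((stepLo P ld.r0l J1 c0l (i - iPrev) 0 : ℕ) : ℝ) ≤ (2 : ℝ) ^ P * (x0 : ℝ) ^ (-((i : ℝ) / E)) := by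
          have := stepLo_le P hx0 hr0l J1 c0l (i - iPrev) 0 _ hc0l; rwa [e1] at this
        have hc0h' : (2 : ℝ) ^ P * (x0 : ℝ) ^ (-((i : ℝ) / E)) ≤ ((stepHi P ld.r0h J1 c0h (i - iPrev) 0 : ℕ) : ℝ) := by
          have := le_stepHi P hx0 hr0h J1 c0h (i - iPrev) 0 _ hiPrev0 hc0h; rwa [e1] at this
        have hc1h' : (2 : ℝ) ^ P * (x1 : ℝ) ^ (-((i : ℝ) / E)) ≤ ((stepHi P ld.r1h J1 c1h (i - iPrev) 0 : ℕ) : ℝ) := by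
          have := le_stepHi P hx1 hr1h J1 c1h (i - iPrev) 0 _ hiPrev0 hc1h; rwa [e1] at this
        have hcml' : ((stepLo P ld.rml J1 cml (i - iPrev) 0 : ℕ) : ℝ) ≤ (2 : ℝ) ^ P * (xm : ℝ) ^ (-((i : ℝ) / E)) := by
          have := stepLo_le P hxm hrml J1 cml (i - iPrev) 0 _ hcml; rwa [e1] at this
        -- the cell, then the rest
        rcases hcell : leafCell b P E ld i (stepLo P ld.r0l J1 c0l (i - iPrev) 0) (stepHi P ld.r0h J1 c0h (i - iPrev) 0)
            (stepHi P ld.r1h J1 c1h (i - iPrev) 0) (stepLo P ld.rml J1 cml (i - iPrev) 0) pref d with _ | ⟨pref', d'⟩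
        · rw [hcell] at h; simp at h
        rw [hcell] at h
        simp only at h
        rcases hrest : leafCells b P E ld i (stepLo P ld.r0l J1 c0l (i - iPrev) 0) (stepHi P ld.r0h J1 c0h (i - iPrev) 0)
            (stepHi P ld.r1h J1 c1h (i - iPrev) 0) (stepLo P ld.rml J1 cml (i - iPrev) 0) cells st₀ with _ | rest
        · rw [hrest] at h; simp at h
        rw [hrest] at h
        simp only [Option.some.injEq] at h
        rw [← h, fcons_eq]
        exact List.Forall₂.cons (H i w _ _ _ _ pref d pref' d' hc0l' hc0h' hc1h' hcml' hhead hcell)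
          (ih st₀ i _ _ _ _ hc0l' hc0h' hc1h' hcml' htail rest hrest)

end LTruncationPacked

end Literature.NumberTheory.LFunctions
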